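import Literature.Analysis.FluidPDE.FluidComputer.ThresholdLevelTableU
import HarnessLib

/-!
# Kernel run of the re-cut table over the 10⁻² box, chunks 40 … 43 (bp3 gen 13, layer 4: robustness variant U)

HONEST FRAMING: low prior, high value-of-information experiment on Tao's machine paradigm; NOT a
claim that NS blows up.

Four kernel evaluations (`decide +kernel`; no `native_decide`, no extra axioms) of the checker
`runSteps` (`ThresholdLevelCheck.lean`) with the interval gate data `GIu` (all seven data within
relative `10⁻²`) on ≤ 25 steps of `ThresholdLevelTableU.stepsU` at a time, from `Bu i` towards the next chunk's
first level, returning `Bu (i+1)` (`Bu 0 = ThresholdLevelTable.Bc0`).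
-/

namespace Literature.Analysis.FluidPDE.FluidComputer

namespace ThresholdLevelTableU

open ThresholdLevelTable (Bc0 RbIt)

set_option maxHeartbeats 10000000 in
set_option maxRecDepth 200000 in
/-- Chunk 40 of the re-cut table run over the 10⁻² box (steps 1000 … 1024). [folklore] -/
theorem runU40 : runSteps 60 12 3 GIu RbIt Bu40 chunkU40 16700209736379186 = some Bu41 := by
  decide +kernel

set_option maxHeartbeats 10000000 in
set_option maxRecDepth 200000 in
/-- Chunk 41 of the re-cut table run over the 10⁻² box (steps 1025 … 1049). [folklore] -/
theorem runU41 : runSteps 60 12 3 GIu RbIt Bu41 chunkU41 18218920983040980 = some Bu42 := by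
  decide +kernel

set_option maxHeartbeats 10000000 in
set_option maxRecDepth 200000 in
/-- Chunk 42 of the re-cut table run over the 10⁻² box (steps 1050 … 1074). [folklore] -/
theorem runU42 : runSteps 60 12 3 GIu RbIt Bu42 chunkU42 19875984256333640 = some Bu43 := by
  decide +kernel

set_option maxHeartbeats 10000000 in
set_option maxRecDepth 200000 in
/-- Chunk 43 of the re-cut table run over the 10⁻² box (steps 1075 … 1099). [folklore] -/
theorem runU43 : runSteps 60 12 3 GIu RbIt Bu43 chunkU43 21683499329800700 = some Bu44 := by
  decide +kernel

end ThresholdLevelTableU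

end Literature.Analysis.FluidPDE.FluidComputer
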